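import Summits.AtomisticToContinuum.HydrodynamicLimit.Theorems.CollisionIsometryCLTMacroClosureEngineBlockClosure
import Summits.AtomisticToContinuum.HydrodynamicLimit.Theorems.CollisionIsometryCLTMacroClosureStubBalanceB1
import HarnessLib

/-!
# Sub-goal `engine_trajectoryIntegrable` of the lead's `engine_incrementBound` (line `IdeatorTwoGen1Sketch`,
# crux `MacroClosure`, stmt-AtomisticToContinuum-14870) — helpers A: block functionals along a continuous path

Support file (`--supports stmt-AtomisticToContinuum-14870`) for the registered sub-goal
`Barycentric.engine_trajectoryIntegrable` (time-integrability of the functionals of the increment bound along one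
good trajectory); it lands the registered helper sub-goal `Barycentric.engine_trajectoryIntegrable_pieces`.
Namespace `Barycentric.EngineTrajectoryIntegrable`:

* `continuous_pathBlocks`, `continuous_pathBlocks'` — along a CONTINUOUS path of configurations `p ↦ w(p)` and a
  continuous centre `p ↦ ξ(p)` the block fields `ρ̄, m̄, Ē` are continuous, and so are `ū, θ̄, D, q` when no
  block is empty (every block functional is a finite sum over the particles);
* `integrableOn_integral_Icc` — Fubini: `G` integrable on `[a, b] × 𝕋³` ⟹ `s ↦ ∫ₓ G(s, x) dx` integrable on
  `[a, b]`; `integrableOn_clm_apply` — a continuous operator field applied to an integrable field on a compact;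
* `integrableOn_pressure_path`, `integrableOn_flux_path` — along a band path (`c₁ ≤ ρ̄ ≤ σ⁻³` everywhere) the
  block pressure `p̄ = ρ̄ θ̄ Z(ρ̄σ³)` (with `Z` measurable, bounded on the band by Ruelle convexity
  `HsFreeEnergyConvex`) and the hs-Euler fluxes `Fⱼ(Ū)` are integrable on compacts of `ℝ × 𝕋³`;
* `pieces` = `engine_trajectoryIntegrable_pieces` — for a classical solution in the chamber of `ThermoChamber η₃`
  and a continuous band path `W` on `[a, b] ⊆ [0, t]`, `t < T`, the three block functionals
  `s ↦ prodBlock(s, W s)`, `s ↦ ∫ₓ ccClosure(s, W s, x) dx`, `s ↦ ∫ₓ (Σ D² + |q|²)(W s)` are integrable on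
  `[a, b]`: their integrands are integrable on `[a, b] × 𝕋³` (jointly continuous block and derivative fields,
  bounded measurable block pressure), hence Fubini.
-/

noncomputable section

open MeasureTheory Filter Set Topology InformationTheory
open scoped ENNReal ContDiff

namespace Summit.AtomisticToContinuum.HydrodynamicLimit.Theorems.MacroClosureLine

open Literature.MathematicalPhysics.KineticTheory Literature.Analysis.FluidPDE
open Literature.Analysis.FunctionSpaces
open Summit.AtomisticToContinuum.HydrodynamicLimit.Theses

namespace Barycentric

namespace EngineTrajectoryIntegrable

/-! ## Block fields along a continuous path of configurations are jointly continuous -/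

section PathBlocks

variable {P : Type*} [TopologicalSpace P] {n : ℕ} {φ : T3 → ℝ}
  {w : P → Config (n + 1) (Fin 3) T3} {ξ : P → T3}

/-- `ρ̄, m̄, Ē` of a continuously moving configuration at a continuously moving centre are continuous. -/
theorem continuous_pathBlocks (hφc : Continuous φ) (hw : Continuous w) (hξ : Continuous ξ) :
    (Continuous fun p => bρ φ (w p) (ξ p)) ∧ (Continuous fun p => bm φ (w p) (ξ p)) ∧
    (Continuous fun p => bE φ (w p) (ξ p)) := by
  have hpos : ∀ i, Continuous fun p => (w p i).1 := fun i => ((continuous_apply i).comp hw).fst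
  have hvel : ∀ i, Continuous fun p => (w p i).2 := fun i => ((continuous_apply i).comp hw).snd
  have hφx : ∀ i, Continuous fun p => φ ((w p i).1 - ξ p) := fun i => hφc.comp ((hpos i).sub hξ)
  refine ⟨?_, ?_, ?_⟩
  · simp only [bρ_eq_sum]
    exact continuous_const.mul (continuous_finsetSum _ fun i _ => hφx i)
  · have e : (fun p => bm φ (w p) (ξ p)) =
        fun p => ((n + 1 : ℕ) : ℝ)⁻¹ • ∑ i, φ ((w p i).1 - ξ p) • (w p i).2 := by
      funext p
      simp only [bm, empiricalMomentumField]
      rw [integral_empiricalMeasure_V3]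
    rw [e]
    exact (continuous_finsetSum _ fun i _ => (hφx i).smul (hvel i)).const_smul (((n + 1 : ℕ) : ℝ)⁻¹)
  · simp only [bE_eq_sum]
    exact continuous_const.mul (continuous_finsetSum _ fun i _ =>
      (hφx i).mul (((hvel i).norm.pow 2).div_const _))

/-- `ū, θ̄, D, q` (and the coordinates of `ū, m̄`) of a continuously moving configuration at a continuously
moving centre are continuous, when no block is empty (`ρ̄ ≠ 0`; as `EngineBlockClosure.continuous_blocks`). -/
theorem continuous_pathBlocks' (hφc : Continuous φ) (hw : Continuous w) (hξ : Continuous ξ)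
    (hρ : ∀ p, bρ φ (w p) (ξ p) ≠ 0) :
    (Continuous fun p => bu φ (w p) (ξ p)) ∧ (∀ j, Continuous fun p => bu φ (w p) (ξ p) j) ∧
    (∀ j, Continuous fun p => bm φ (w p) (ξ p) j) ∧ (Continuous fun p => bθ φ (w p) (ξ p)) ∧
    (∀ j k, Continuous fun p => bD φ (w p) (ξ p) j k) ∧ (Continuous fun p => bq φ (w p) (ξ p)) := by
  obtain ⟨hρc, hmc, hEc⟩ := continuous_pathBlocks hφc hw hξ
  have hpos : ∀ i, Continuous fun p => (w p i).1 := fun i => ((continuous_apply i).comp hw).fst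
  have hvel : ∀ i, Continuous fun p => (w p i).2 := fun i => ((continuous_apply i).comp hw).snd
  have hφx : ∀ i, Continuous fun p => φ ((w p i).1 - ξ p) := fun i => hφc.comp ((hpos i).sub hξ)
  have hproj : ∀ {f : P → V3}, Continuous f → ∀ j, Continuous fun p => f p j := fun hf j =>
    (EuclideanSpace.proj j : V3 →L[ℝ] ℝ).continuous.comp hf
  have hu : Continuous fun p => bu φ (w p) (ξ p) := (hρc.inv₀ hρ).smul hmc
  have huj : ∀ j, Continuous fun p => bu φ (w p) (ξ p) j := hproj hu
  have hvj : ∀ i j, Continuous fun p => (w p i).2 j := fun i => hproj (hvel i)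
  have hθ : Continuous fun p => bθ φ (w p) (ξ p) := by
    refine continuous_const.mul ((hEc.div hρc hρ).sub ((hmc.norm.pow 2).div
      (continuous_const.mul (hρc.pow 2)) fun p => ?_))
    exact mul_ne_zero two_ne_zero (pow_ne_zero 2 (hρ p))
  have hD : ∀ j k, Continuous fun p => bD φ (w p) (ξ p) j k := by
    intro j k
    have hA : Continuous fun p => ∫ y, φ (y.1 - ξ p) *
        ((y.2 j - bu φ (w p) (ξ p) j) * (y.2 k - bu φ (w p) (ξ p) k)) ∂(empiricalMeasure (w p)) := by
      simp only [integral_weight_mul_eq_sum]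
      exact continuous_const.mul (continuous_finsetSum _ fun i _ => (hφx i).mul
        (((hvj i j).sub (huj j)).mul ((hvj i k).sub (huj k))))
    have hB : Continuous fun p => (∑ l : Fin 3, ∫ y, φ (y.1 - ξ p) * (y.2 l - bu φ (w p) (ξ p) l) ^ 2
        ∂(empiricalMeasure (w p))) / 3 := by
      simp only [integral_weight_mul_eq_sum]
      exact (continuous_finsetSum _ fun l _ => continuous_const.mul
        (continuous_finsetSum _ fun i _ => (hφx i).mul (((hvj i l).sub (huj l)).pow 2))).div_const _
    by_cases hjk : j = k
    · simp only [bD, hjk, if_true]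
      subst hjk
      exact hA.sub hB
    · simp only [bD, hjk, if_false]
      exact hA.sub continuous_const
  have hq : Continuous fun p => bq φ (w p) (ξ p) := by
    have e : (fun p => bq φ (w p) (ξ p)) = fun p => ((n + 1 : ℕ) : ℝ)⁻¹ •
        ∑ i, (φ ((w p i).1 - ξ p) * ‖(w p i).2 - bu φ (w p) (ξ p)‖ ^ 2 / 2) •
          ((w p i).2 - bu φ (w p) (ξ p)) := by
      funext p
      simp only [bq]
      rw [integral_empiricalMeasure_V3]
    rw [e]
    exact (continuous_finsetSum _ fun i _ =>
      (((hφx i).mul (((hvel i).sub hu).norm.pow 2)).div_const _).smul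
        ((hvel i).sub hu)).const_smul (((n + 1 : ℕ) : ℝ)⁻¹)
  exact ⟨hu, huj, hproj hmc, hθ, hD, hq⟩

end PathBlocks

/-! ## Fubini on `[a, b] × 𝕋³` and the band pressure along a path -/

section Fubini

variable {n : ℕ}

/-- **Fubini.** If `G` is integrable on `[a, b] × 𝕋³`, then `s ↦ ∫ₓ G(s, x) dx` is integrable on
`[a, b]` (`Integrable.integral_prod_left` for `vol|[a,b] ⊗ vol`). -/
theorem integrableOn_integral_Icc {a b : ℝ} {G : ℝ × T3 → ℝ}
    (hG : IntegrableOn G (Icc a b ×ˢ univ) volume) :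
    IntegrableOn (fun s => ∫ x, G (s, x)) (Icc a b) := by
  have hμ := Measure.prod_restrict (μ := (volume : Measure ℝ)) (ν := (volume : Measure T3))
    (Icc a b) univ
  rw [Measure.restrict_univ] at hμ
  have h : Integrable G ((volume.restrict (Icc a b)).prod volume) := by
    rw [hμ]
    exact hG
  exact h.integral_prod_left

/-- A continuous operator field on a compact `K ⊆ ℝ × 𝕋³` applied to a field integrable on `K` is
integrable on `K` (`‖L(p)G(p)‖ ≤ (sup_K ‖L‖) ‖G(p)‖`). -/
theorem integrableOn_clm_apply {E' : Type*} [NormedAddCommGroup E'] [NormedSpace ℝ E']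
    {K : Set (ℝ × T3)} (hK : IsCompact K) {L : ℝ × T3 → (E' →L[ℝ] ℝ)} {G : ℝ × T3 → E'}
    (hL : ContinuousOn L K) (hG : IntegrableOn G K volume) :
    IntegrableOn (fun p => L p (G p)) K volume := by
  obtain ⟨C, hC⟩ := hK.exists_bound_of_continuousOn hL
  have hKm : MeasurableSet K := hK.measurableSet
  refine Integrable.mono' (hG.norm.const_mul C) ?_ ?_
  · exact (show Continuous fun q : (E' →L[ℝ] ℝ) × E' => q.1 q.2 from
      isBoundedBilinearMap_apply.continuous).comp_aestronglyMeasurable₂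
        (hL.aestronglyMeasurable hKm) hG.aestronglyMeasurable
  · filter_upwards [ae_restrict_mem hKm] with p hp
    exact (L p).le_of_opNorm_le (hC p hp) (G p)

/-- **The block pressure along a band path is integrable on compacts of `ℝ × 𝕋³`:**
`p̄ = ρ̄ θ̄ Z(ρ̄σ³)` with `ρ̄ θ̄` jointly continuous and `Z(ρ̄σ³)` measurable and bounded by `1 + C_Z` on the
band (Ruelle convexity, `HsFreeEnergyConvex`; as `EngineBlockClosure.integrable_pressure`). -/
theorem integrableOn_pressure_path (hH : StiffCollisionalRelaxation.HsFreeEnergyConvex) {σ c₁ : ℝ}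
    (hσ : 0 < σ) (hc₁ : 0 < c₁) {φ : T3 → ℝ} (hφc : Continuous φ)
    {W : ℝ → Config (n + 1) (Fin 3) T3} (hW : Continuous W)
    (hband : ∀ s x, c₁ ≤ bρ φ (W s) x ∧ bρ φ (W s) x * σ ^ 3 ≤ 1) {K : Set (ℝ × T3)}
    (hK : IsCompact K) :
    IntegrableOn (fun p : ℝ × T3 => hsPressure σ (bρ φ (W p.1) p.2) (bθ φ (W p.1) p.2)) K volume := by
  obtain ⟨C, -, hC⟩ := HemisphereAffineSlaving.abs_hsCompressibility_sub_one_le hH σ hσ c₁ hc₁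
  have hw : Continuous fun p : ℝ × T3 => W p.1 := hW.comp continuous_fst
  obtain ⟨hρc, -, -⟩ := continuous_pathBlocks hφc hw continuous_snd
  have hρ0 : ∀ p : ℝ × T3, bρ φ (W p.1) p.2 ≠ 0 := fun p => (hc₁.trans_le (hband p.1 p.2).1).ne'
  obtain ⟨-, -, -, hθc, -⟩ := continuous_pathBlocks' hφc hw continuous_snd hρ0
  have hZ : Measurable hsCompressibility := by
    have h : hsCompressibility = fun η => 1 + η * deriv hsExcessFreeEnergy η := rfl
    rw [h]
    exact measurable_const.add (measurable_id.mul (measurable_deriv _))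
  have h1 : IntegrableOn (fun p : ℝ × T3 => bρ φ (W p.1) p.2 * bθ φ (W p.1) p.2) K volume :=
    (hρc.mul hθc).continuousOn.integrableOn_compact hK
  have h2 : AEStronglyMeasurable (fun p : ℝ × T3 => hsCompressibility (bρ φ (W p.1) p.2 * σ ^ 3))
      (volume.restrict K) :=
    (hZ.comp (hρc.mul continuous_const).measurable).aestronglyMeasurable
  have h3 : ∀ p : ℝ × T3, ‖hsCompressibility (bρ φ (W p.1) p.2 * σ ^ 3)‖ ≤ C + 1 := fun p => by
    have h := hC (bρ φ (W p.1) p.2) (hband p.1 p.2).1 (hband p.1 p.2).2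
    rw [Real.norm_eq_abs]
    calc |hsCompressibility (bρ φ (W p.1) p.2 * σ ^ 3)|
        = |(hsCompressibility (bρ φ (W p.1) p.2 * σ ^ 3) - 1) + 1| := by rw [sub_add_cancel]
      _ ≤ |hsCompressibility (bρ φ (W p.1) p.2 * σ ^ 3) - 1| + |(1 : ℝ)| := abs_add_le _ _
      _ ≤ C + 1 := by rw [abs_one]; linarith
  exact h1.mul_bdd h2 (ae_of_all _ h3)

/-- **The hs-Euler fluxes of the block state along a band path are integrable on compacts of
`ℝ × 𝕋³`:** `Fⱼ(Ū) = (m̄ⱼ, (m̄ⱼ/ρ̄) m̄ + p̄ eⱼ, (Ē + p̄) m̄ⱼ/ρ̄)` with jointly continuous block fields,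
`ρ̄ ≥ c₁ > 0`, and the block pressure of `integrableOn_pressure_path`
(as `EngineProductionBound.integrable_flux_bU`). -/
theorem integrableOn_flux_path (hH : StiffCollisionalRelaxation.HsFreeEnergyConvex) {σ c₁ : ℝ}
    (hσ : 0 < σ) (hc₁ : 0 < c₁) {φ : T3 → ℝ} (hφc : Continuous φ)
    {W : ℝ → Config (n + 1) (Fin 3) T3} (hW : Continuous W)
    (hband : ∀ s x, c₁ ≤ bρ φ (W s) x ∧ bρ φ (W s) x * σ ^ 3 ≤ 1) {K : Set (ℝ × T3)}
    (hK : IsCompact K) (j : Fin 3) :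
    IntegrableOn (fun p : ℝ × T3 => eulerFlux σ j (bU φ (W p.1) p.2)) K volume := by
  have hw : Continuous fun p : ℝ × T3 => W p.1 := hW.comp continuous_fst
  obtain ⟨hρc, hmc, hEc⟩ := continuous_pathBlocks hφc hw continuous_snd
  have hρ0 : ∀ p : ℝ × T3, bρ φ (W p.1) p.2 ≠ 0 := fun p => (hc₁.trans_le (hband p.1 p.2).1).ne'
  obtain ⟨-, -, hmj, -, -⟩ := continuous_pathBlocks' hφc hw continuous_snd hρ0
  have hKm : MeasurableSet K := hK.measurableSet
  have hp := integrableOn_pressure_path hH hσ hc₁ hφc hW hband hK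
  have hq : Continuous fun p : ℝ × T3 => bm φ (W p.1) p.2 j / bρ φ (W p.1) p.2 :=
    (hmj j).div hρc hρ0
  obtain ⟨C, hC⟩ := hK.exists_bound_of_continuousOn hq.continuousOn
  have i1 : IntegrableOn (fun p : ℝ × T3 => bm φ (W p.1) p.2 j) K volume :=
    (hmj j).continuousOn.integrableOn_compact hK
  have i2 : IntegrableOn (fun p : ℝ × T3 => (bm φ (W p.1) p.2 j / bρ φ (W p.1) p.2) • bm φ (W p.1) p.2 +
      hsPressure σ (bρ φ (W p.1) p.2) (bθ φ (W p.1) p.2) • EuclideanSpace.single j (1 : ℝ)) K volume :=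
    ((hq.smul hmc).continuousOn.integrableOn_compact hK).add (hp.smul_const _)
  have i3 : IntegrableOn (fun p : ℝ × T3 =>
      (bE φ (W p.1) p.2 + hsPressure σ (bρ φ (W p.1) p.2) (bθ φ (W p.1) p.2)) *
        bm φ (W p.1) p.2 j / bρ φ (W p.1) p.2) K volume := by
    have hEp : IntegrableOn (fun p : ℝ × T3 =>
        bE φ (W p.1) p.2 + hsPressure σ (bρ φ (W p.1) p.2) (bθ φ (W p.1) p.2)) K volume :=
      (hEc.continuousOn.integrableOn_compact hK).add hp
    have h : IntegrableOn (fun p : ℝ × T3 =>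
        (bE φ (W p.1) p.2 + hsPressure σ (bρ φ (W p.1) p.2) (bθ φ (W p.1) p.2)) *
          (bm φ (W p.1) p.2 j / bρ φ (W p.1) p.2)) K volume :=
      hEp.mul_bdd hq.aestronglyMeasurable
        ((ae_restrict_iff' hKm).2 (ae_of_all _ fun p hp => hC p hp))
    exact h.congr (Eventually.of_forall fun p => (mul_div_assoc _ _ _).symm)
  have e : (fun p : ℝ × T3 => eulerFlux σ j (bU φ (W p.1) p.2)) = fun p => (bm φ (W p.1) p.2 j,
      (bm φ (W p.1) p.2 j / bρ φ (W p.1) p.2) • bm φ (W p.1) p.2 +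
        hsPressure σ (bρ φ (W p.1) p.2) (bθ φ (W p.1) p.2) • EuclideanSpace.single j (1 : ℝ),
      (bE φ (W p.1) p.2 + hsPressure σ (bρ φ (W p.1) p.2) (bθ φ (W p.1) p.2)) *
        bm φ (W p.1) p.2 j / bρ φ (W p.1) p.2) := rfl
  rw [e]
  exact i1.prodMk (i2.prodMk i3)

end Fubini

/-! ## The three block functionals along a band path -/

section Solution

variable {σ η₃ T : ℝ} {ρ θ : ℝ → T3 → ℝ} {u : ℝ → T3 → V3} {n : ℕ}

/-- **Block functionals along a continuous band path are integrable in time** (`[a, b] ⊆ [0, t]`,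
`t < T`): the integrands of `prodBlock`, `∫ₓ ccClosure` and of the kinetic defect `∫ₓ (Σ D² + |q|²)` are
integrable on `[a, b] × 𝕋³` (jointly continuous block fields and derivative fields, bounded measurable
block pressure), hence Fubini. -/
theorem pieces (hH : StiffCollisionalRelaxation.HsFreeEnergyConvex) (hσ : 0 < σ)
    (hE : IsHardSphereEulerSolution σ T ρ u θ) (hT : ThermoChamber η₃)
    (hpack : ∀ s ∈ Ico 0 T, ∀ x, ρ s x * σ ^ 3 < η₃) {t : ℝ} (htT : t < T) {c₁ : ℝ} (hc₁ : 0 < c₁)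
    {φ : T3 → ℝ} (hφc : Continuous φ) {W : ℝ → Config (n + 1) (Fin 3) T3} (hW : Continuous W)
    (hband : ∀ s x, c₁ ≤ bρ φ (W s) x ∧ bρ φ (W s) x * σ ^ 3 ≤ 1) {a b : ℝ} (ha : 0 ≤ a)
    (hb : b ≤ t) :
    IntegrableOn (fun s => prodBlock σ T ρ θ u φ s (W s)) (Icc a b) ∧
    IntegrableOn (fun s => ∫ x, ccClosure σ θ u φ s (W s) x) (Icc a b) ∧
    IntegrableOn (fun s => ∫ x, ((∑ j, ∑ k, bD φ (W s) x j k ^ 2) + ‖bq φ (W s) x‖ ^ 2)) (Icc a b) := by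
  obtain ⟨hΛ, -, hM, hEE, -⟩ := EngineBlockClosure.lam_smooth hσ hE hT hpack
  have hU : UniqueDiffOn ℝ (Ico (0 : ℝ) T) := uniqueDiffOn_Ico 0 T
  have hK : IsCompact (Icc a b ×ˢ (univ : Set T3)) := isCompact_Icc.prod isCompact_univ
  have hKm : MeasurableSet (Icc a b ×ˢ (univ : Set T3)) := hK.measurableSet
  have hKS : Icc a b ×ˢ (univ : Set T3) ⊆ Ico 0 T ×ˢ univ :=
    prod_mono (fun s hs => ⟨ha.trans hs.1, (hs.2.trans hb).trans_lt htT⟩) subset_rfl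
  -- joint continuity of the block fields along the path and of the derivative fields
  have hw : Continuous fun p : ℝ × T3 => W p.1 := hW.comp continuous_fst
  obtain ⟨hρc, hmc, hEc⟩ := continuous_pathBlocks hφc hw continuous_snd
  have hρ0 : ∀ p : ℝ × T3, bρ φ (W p.1) p.2 ≠ 0 := fun p => (hc₁.trans_le (hband p.1 p.2).1).ne'
  obtain ⟨-, huj, -, hθc, hD, hq⟩ := continuous_pathBlocks' hφc hw continuous_snd hρ0
  have cLt : ContinuousOn (fun p : ℝ × T3 => Torus.timeDerivWithin (Ico 0 T) (Lcl σ ρ θ u) p.1 p.2)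
      (Icc a b ×ˢ univ) :=
    (continuousOn_uncurry_of_stLift (hΛ.timeDerivWithin hU).continuousOn_stLift).mono hKS
  have cLx : ∀ j, ContinuousOn (fun p : ℝ × T3 => Torus.partialDeriv j (Lcl σ ρ θ u p.1) p.2)
      (Icc a b ×ˢ univ) := fun j =>
    (continuousOn_uncurry_of_stLift (hΛ.partialDeriv hU j).continuousOn_stLift).mono hKS
  have cdiv : ContinuousOn (fun p : ℝ × T3 => Torus.divergence (lamM θ u p.1) p.2) (Icc a b ×ˢ univ) :=
    (continuousOn_uncurry_of_stLift (hM.divergence hU).continuousOn_stLift).mono hKS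
  have cgrad : ∀ j, ContinuousOn (fun p : ℝ × T3 => Torus.gradient (lamE θ p.1) p.2 j)
      (Icc a b ×ˢ univ) := fun j =>
    (continuousOn_uncurry_of_stLift ((hEE.gradient hU).apply j).continuousOn_stLift).mono hKS
  refine ⟨?_, ?_, ?_⟩
  · -- the block production
    have hbU : Continuous fun p : ℝ × T3 => bU φ (W p.1) p.2 := hρc.prodMk (hmc.prodMk hEc)
    have i1 : IntegrableOn (fun p : ℝ × T3 =>
        Torus.timeDerivWithin (Ico 0 T) (Lcl σ ρ θ u) p.1 p.2 (bU φ (W p.1) p.2))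
        (Icc a b ×ˢ univ) volume :=
      (cLt.clm_apply hbU.continuousOn).integrableOn_compact hK
    have i2 : ∀ j, IntegrableOn (fun p : ℝ × T3 =>
        Torus.partialDeriv j (Lcl σ ρ θ u p.1) p.2 (eulerFlux σ j (bU φ (W p.1) p.2)))
        (Icc a b ×ˢ univ) volume := fun j =>
      integrableOn_clm_apply hK (cLx j) (integrableOn_flux_path hH hσ hc₁ hφc hW hband hK j)
    have hG : IntegrableOn (fun p : ℝ × T3 =>
        Torus.timeDerivWithin (Ico 0 T) (Lcl σ ρ θ u) p.1 p.2 (bU φ (W p.1) p.2) +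
          ∑ j, Torus.partialDeriv j (Lcl σ ρ θ u p.1) p.2 (eulerFlux σ j (bU φ (W p.1) p.2)))
        (Icc a b ×ˢ univ) volume :=
      i1.add (integrable_finsetSum _ fun j _ => i2 j)
    unfold prodBlock
    exact integrableOn_integral_Icc hG
  · -- the collisional closure
    have hpref : ContinuousOn (fun p : ℝ × T3 => Torus.divergence (lamM θ u p.1) p.2 +
        ∑ j, Torus.gradient (lamE θ p.1) p.2 j * bu φ (W p.1) p.2 j) (Icc a b ×ˢ univ) :=
      cdiv.add (continuousOn_finsetSum _ fun j _ => (cgrad j).mul (huj j).continuousOn)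
    obtain ⟨C, hC⟩ := hK.exists_bound_of_continuousOn hpref
    have hdiff : IntegrableOn (fun p : ℝ × T3 =>
        hsPressure σ (bρ φ (W p.1) p.2) (bθ φ (W p.1) p.2) - bρ φ (W p.1) p.2 * bθ φ (W p.1) p.2)
        (Icc a b ×ˢ univ) volume :=
      (integrableOn_pressure_path hH hσ hc₁ hφc hW hband hK).sub
        ((hρc.mul hθc).continuousOn.integrableOn_compact hK)
    have hG := hdiff.bdd_mul (hpref.aestronglyMeasurable hKm)
      ((ae_restrict_iff' hKm).2 (ae_of_all _ fun p hp => hC p hp))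
    unfold ccClosure
    exact integrableOn_integral_Icc hG
  · -- the kinetic defect
    have hc : Continuous fun p : ℝ × T3 =>
        (∑ j, ∑ k, bD φ (W p.1) p.2 j k ^ 2) + ‖bq φ (W p.1) p.2‖ ^ 2 :=
      (continuous_finsetSum _ fun j _ => continuous_finsetSum _ fun k _ => (hD j k).pow 2).add
        (hq.norm.pow 2)
    exact integrableOn_integral_Icc (hc.continuousOn.integrableOn_compact hK)

end Solution

end EngineTrajectoryIntegrable

open EngineTrajectoryIntegrable in
/-- Registered helper sub-goal `engine_trajectoryIntegrable_pieces` of `engine_trajectoryIntegrable`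
(`EngineTrajectoryIntegrable.pieces`): for a classical hs-Euler solution in the chamber of `ThermoChamber η₃`,
`t < T`, a band floor `c₁ > 0`, a continuous kernel `φ` and a CONTINUOUS path of configurations `W` all of whose
blocks lie in the band `c₁ ≤ ρ̄ ≤ σ⁻³`, the block production `s ↦ prodBlock(s, W s)`, the collisional closure
`s ↦ ∫ₓ ccClosure(s, W s, x) dx` and the kinetic defect `s ↦ ∫ₓ (Σ D² + |q|²)(W s)` are integrable on every
`[a, b] ⊆ [0, t]` (joint continuity of block and derivative fields, bounded measurable block pressure, Fubini).
[folklore] -/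
theorem engine_trajectoryIntegrable_pieces : ∀ (σ : ℝ), 0 < σ → StiffCollisionalRelaxation.HsFreeEnergyConvex → ∀ (T : ℝ) (ρ θ : ℝ → T3 → ℝ) (u : ℝ → T3 → V3), IsHardSphereEulerSolution σ T ρ u θ → ∀ η₃ : ℝ, ThermoChamber η₃ → (∀ s ∈ Ico 0 T, ∀ x, ρ s x * σ ^ 3 < η₃) → ∀ t : ℝ, t < T → ∀ c₁ : ℝ, 0 < c₁ → ∀ (n : ℕ) (φ : T3 → ℝ), Continuous φ → ∀ W : ℝ → Config (n + 1) (Fin 3) T3, Continuous W → (∀ (s : ℝ) (x : T3), c₁ ≤ bρ φ (W s) x ∧ bρ φ (W s) x * σ ^ 3 ≤ 1) → ∀ a b : ℝ, 0 ≤ a → b ≤ t → IntegrableOn (fun s => prodBlock σ T ρ θ u φ s (W s)) (Icc a b) ∧ IntegrableOn (fun s => ∫ x, ccClosure σ θ u φ s (W s) x) (Icc a b) ∧ IntegrableOn (fun s => ∫ x, ((∑ j, ∑ k, bD φ (W s) x j k ^ 2) + ‖bq φ (W s) x‖ ^ 2)) (Icc a b) :=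
  fun _ hσ hH _ _ _ _ hE _ hT hpack _ htT _ hc₁ _ _ hφc _ hW hband _ _ ha hb =>
    pieces hH hσ hE hT hpack htT hc₁ hφc hW hband ha hb

end Barycentric

end Summit.AtomisticToContinuum.HydrodynamicLimit.Theorems.MacroClosureLine

end
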